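import Literature.IUT.LogThetaLattice.LatticeGlue
import HarnessLib

/-!
# [IUTchIII] Corollary 2.3 (iii): (e_ℜ) relative to the Kummer isomorphisms of Prop 2.1 (ii) / Thm 1.5 (iii) and the
# horizontal arrows, at the level of `F^{⊢×μ}`-prime-strips over the §1–§2 glue (proof companion of `RadialData.lean`)

Mochizuki, *Inter-universal Teichmüller Theory III*, kurims manuscript (May 2020), §2, Corollary 2.3 (iii), p. 75
[cite: Mochizuki2012, III Cor 2.3 (iii) p.75] (D-0012 claim key, status DISPUTED). Companion (abc-iut cell, layer L6,
DISCHARGE-L6 §F row F8, sub-DAG `plan/L6/SUBDAG-IUTchIII-Cor-23.md` rows r9–r12; SUPPLEMENT to abc-iut-w4-d026's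
census file `EtalePictureThetaProofs.lean` — not imported, nothing restated: that file works with the Kummer
isomorphism `kummerT` of the LINK data and at the `F^⊩`-level `kummerFglAt`; this one places the Kummer isomorphism
of Prop 2.1 (ii) ON the `F^{⊢×μ}`-prime-strips of (e_ℜ)'s domain and Thm 1.5 (iii)'s ON (e_ℜ)'s codomain, both on
`RadialData`'s objects): elementary category theory over `LatticeGlue` (`LatticeGlue.lean`: ONE set of §1–§2 objects);
nothing here asserts a disputed claim or takes a side on [IUTchIII] Cor 3.12.

Printed text (p.75): "(iii) The [poly-]isomorphisms of `F^{⊢×μ}`-prime-strips of/induced by (e_ℜ), (b_{Morℜ}), (d_{Morℜ})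
[cf. also (e_{Morℜ})] are compatible, relative to the Kummer isomorphisms of Proposition 2.1, (ii) [cf. also
Proposition 2.1, (vi)], and Theorem 1.5, (iii), with the poly-isomorphisms — arising from the horizontal arrows of
the Gaussian log-theta-lattice — of Theorem 1.5, (ii)."

What is DEFINED (compositions of glue data, plain-typed so that they compose literally with `Radial.envToDelta`)
and PROVED.
* `LatticeGlue.kummerEnvNat` / `kummerEnvAt` (row r9, Prop 2.1 (ii)): the Kummer isomorphism
  `†F^{⊢×μ}_{env} ⥲ F^{⊢×μ}_{env}(†D_>)` — `ThetaMonoidData.kummerFgl` on `F^{⊢×μ}`-prime-strips, landing in `RadialData`'s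
  `F^{⊢×μ}_{env}(†D_>)` through `fglEnv_iso` — NATURAL in `†HT` (`kummerEnvAt_naturality`, `kummerEnvAt_conj`: the
  Kummer-conjugate of the Frobenius-like induced isomorphism is the étale-like (b_{Morℜ}) one).
* `LatticeGlue.fxmDeltaGlueAt`, `kummerDeltaAt`, `kummerDeltaTransport` (row r12, Thm 1.5 (iii)): the Kummer
  isomorphism `^{n,m}F^{⊢×μ}_△ ⥲ F^{⊢×μ}_△(^{n,m}D^⊢_△)` onto `RadialData`'s copy and the transport of Frobenius-like
  isomorphisms along it (= `BiCoricData.kummerTransport` conjugated by the glue, `kummerDeltaTransport_eq`); the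
  transport of the FULL poly-isomorphism of Thm 1.5 (ii) is full (`image_kummerDeltaTransport_full`, abc-iut-L6-t3's
  `kummerTransport_image_full` moved along the glue; row r11).
* Row r10, Prop 2.1 (vi): the natural isomorphism `F^{⊢×}_△(†D^⊢_△) ⥲ F^{⊢×}_{env}(†D_>)` (`LatticeGlue.envNatE`) is a
  constituent of [the inverse of] (e_ℜ) (`envNatE_mem_envToDelta`).
* (iii) proper: `single_kummerEnvAt_comp_envToDelta`, `cor23iii_kummer_full` ((e_ℜ) transported along BOTH Kummer
  isomorphisms is the full poly-isomorphism `†F^{⊢×μ}_{env} ⥲ †F^{⊢×μ}_△`), `cor23iii_comp_full` (mechanism),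
  `cor23iii_horizontal_full` ((e_ℜ) followed by the Kummer transport of the full poly-isomorphism of the horizontal
  arrow is full), `cor23iii_bMor_compatible` ((b_{Morℜ}), (d_{Morℜ}), (e_{Morℜ}) relative to the Kummer isomorphism, via
  `Radial.Hom.compatible_envToDelta`).

Deliberately NOT here: Cor 2.3 (i), (ii), (iv) (`EtalePictureThetaProofs.lean`, `EtalePictureChainProofs.lean`).
Non-vacuity: `LatticeGlue` is inhabited (`StripFrameWitness.twoGlue`, abc-iut-L6-t3). Typed ≠ endorsed.
-/

namespace Literature.IUT.LogThetaLattice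

open CategoryTheory
open Literature.IUT.HodgeTheaters

universe u

variable {S : StripFrame.{u}}

namespace LatticeGlue

variable (G : LatticeGlue S)

/-! #### Cor 2.3 (iii): (e_ℜ) relative to the Kummer isomorphisms of Prop 2.1 (ii) and Thm 1.5 (iii) -/

/-- **IUTchIII:Cor2.3(iii)** (kurims p.75) ↦ **Prop 2.1 (ii)** (kurims p.59) the Kummer isomorphism
"`†F^⊩_{env} ⥲ F^⊩_{env}(†D_>)`" (`ThetaMonoidData.kummerFgl`) on the associated `F^{⊢×μ}`-prime-strips, landing in
`RadialData`'s `F^{⊢×μ}_{env}(†D_>)` (the domain of (e_ℜ)) through the glue `fglEnv_iso`, as a NATURAL isomorphism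
`†F^{⊢×μ}_{env} ⥲ F^{⊢×μ}_{env}(†D_>)` of functors of `†HT` (sub-DAG row Cor-23.iii.r9). [claim: Mochizuki2012, status: disputed] -/
def kummerEnvNat : G.thetaMonoid.FglEnvHT ⋙ (S.FglToFv ⋙ S.FvToFxm) ≅ S.htToD ⋙ G.coric.fxmEnv :=
  Functor.isoWhiskerRight (G.thetaMonoid.kummerFgl ≪≫ Functor.isoWhiskerLeft S.htToD G.fglEnv_iso.symm)
    (S.FglToFv ⋙ S.FvToFxm)

/-- **IUTchIII:Cor2.3(iii)** (kurims p.75) ↦ **Prop 2.1 (ii)** (kurims p.59) the Kummer isomorphism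
`†F^{⊢×μ}_{env} ⥲ F^{⊢×μ}_{env}(†D_>)` at one Hodge theater `†HT` (component of `kummerEnvNat`).
[claim: Mochizuki2012, status: disputed] -/
def kummerEnvAt (X : S.HT) :
    (S.FglToFv ⋙ S.FvToFxm).obj (G.thetaMonoid.FglEnvHT.obj X) ≅ G.coric.fxmEnv.obj (S.htToD.obj X) :=
  G.kummerEnvNat.app X

/-- **IUTchIII:Cor2.3(iii)** (kurims p.75) ↦ **Prop 2.1 (ii)**: `kummerEnvAt` unfolded — the image on
`F^{⊢×μ}`-prime-strips of `ThetaMonoidData.kummerFglAt` followed by the glue identification `fglEnv_iso`.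
[claim: Mochizuki2012, status: disputed] -/
theorem kummerEnvAt_hom (X : S.HT) :
    (G.kummerEnvAt X).hom = (S.FglToFv ⋙ S.FvToFxm).map
      ((G.thetaMonoid.kummerFglAt X).hom ≫ G.fglEnv_iso.inv.app (S.htToD.obj X)) := rfl

/-- **IUTchIII:Cor2.3(iii)** (kurims p.75) ↦ **Prop 2.1 (ii)**: naturality of the Kummer isomorphism in the Hodge
theater — for `ξ : †HT → ‡HT` the Frobenius-like induced morphism `†F^{⊢×μ}_{env} → ‡F^{⊢×μ}_{env}` and the étale-like one
`F^{⊢×μ}_{env}(†D_>) → F^{⊢×μ}_{env}(‡D_>)` induced by `D(ξ)` correspond (from `ThetaMonoidData.kummerFgl` and the glue).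
[claim: Mochizuki2012, status: disputed] -/
theorem kummerEnvAt_naturality {X X' : S.HT} (ξ : X ⟶ X') :
    (S.FglToFv ⋙ S.FvToFxm).map (G.thetaMonoid.FglEnvHT.map ξ) ≫ (G.kummerEnvAt X').hom =
      (G.kummerEnvAt X).hom ≫ G.coric.fxmEnv.map (S.htToD.map ξ) :=
  G.kummerEnvNat.hom.naturality ξ

/-- **IUTchIII:Cor2.3(iii)** (kurims p.75) ↦ **Prop 2.1 (ii)**, isomorphism form: conjugating the Frobenius-like induced
isomorphism `†F^{⊢×μ}_{env} ⥲ ‡F^{⊢×μ}_{env}` of an isomorphism `ξ : †HT ⥲ ‡HT` (e.g. a constituent of a vertical log-link) by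
the Kummer isomorphisms gives the étale-like isomorphism induced by `D(ξ)` — the (b_{Morℜ})-component of the morphism
of radial data `Radial.Hom.ofDHT D(ξ)` on `F^{⊢×μ}`-prime-strips. [claim: Mochizuki2012, status: disputed] -/
theorem kummerEnvAt_conj {X X' : S.HT} (ξ : X ≅ X') :
    (G.kummerEnvAt X).symm ≪≫ (S.FglToFv ⋙ S.FvToFxm).mapIso (G.thetaMonoid.FglEnvHT.mapIso ξ) ≪≫
        G.kummerEnvAt X' = G.coric.fxmEnv.mapIso (S.htToD.mapIso ξ) := by
  ext
  simp only [Iso.trans_hom, Iso.symm_hom, Functor.mapIso_hom]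
  rw [G.kummerEnvAt_naturality ξ.hom, Iso.inv_hom_id_assoc]

/-- **IUTchIII:Thm1.5(iii)** (kurims p.49) the glue identification of `RadialData`'s copy of `F^{⊢×μ}_△(†D^⊢_△)` with
`BiCores`' copy (`LatticeGlue.fxmDeltaE_iso`) at one `D`-Hodge theater, with syntactically plain type (so that it
composes literally with `Radial.envToDelta` and `BiCoricData.kummerAt`). [claim: Mochizuki2012, status: disputed] -/
def fxmDeltaGlueAt (H : S.DHT) :
    G.coric.fxmOfDv.obj (G.coric.dvDelta.obj H) ≅ G.biCoric.fxmOfDv.obj (G.biCoric.dvDelta.obj H) where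
  hom := G.fxmDeltaE_iso.hom.app H
  inv := G.fxmDeltaE_iso.inv.app H
  hom_inv_id := G.fxmDeltaE_iso.hom_inv_id_app H
  inv_hom_id := G.fxmDeltaE_iso.inv_hom_id_app H

/-- **IUTchIII:Cor2.3(iii)** (kurims p.75) ↦ **Thm 1.5 (iii)** (kurims p.50) the Kummer isomorphism
"`^{n,m}F^{⊢×μ}_△ ⥲ F^{⊢×μ}_△(^{n,m}D^⊢_△)`" (`BiCoricData.kummerAt`) landing in `RadialData`'s copy of `F^{⊢×μ}_△(†D^⊢_△)` — the
codomain of (e_ℜ) — through the glue `fxmDeltaGlueAt` (sub-DAG row Cor-23.iii.r12). [claim: Mochizuki2012, status: disputed] -/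
def kummerDeltaAt (X : S.HT) :
    G.biCoric.fxmDeltaHT.obj X ≅ G.coric.fxmOfDv.obj (G.coric.dvDelta.obj (S.htToD.obj X)) :=
  G.biCoric.kummerAt X ≪≫ (G.fxmDeltaGlueAt (S.htToD.obj X)).symm

/-- **IUTchIII:Cor2.3(iii)** (kurims p.75) ↦ **Prop 2.1 (vi)** (kurims p.61) "[cf. also Proposition 2.1, (vi)]": the
natural isomorphism `F^{⊢×}_△(†D^⊢_△) ⥲ F^{⊢×}_{env}(†D_>)` of Prop 2.1 (vi) (on `RadialData`'s objects through the glue,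
`LatticeGlue.envNatE`) is a CONSTITUENT of [the inverse of] the full poly-isomorphism (e_ℜ)
`F^{⊢×μ}_{env}(†D_>) ⥲ F^{⊢×μ}_△(†D^⊢_△)` (sub-DAG row Cor-23.iii.r10). [claim: Mochizuki2012, status: disputed] -/
theorem envNatE_mem_envToDelta (H : S.DHT) :
    (G.envNatE.app H).symm ∈ Radial.envToDelta (E := G.coric) ⟨H⟩ :=
  PolyIso.mem_full _

/-- **IUTchIII:Cor2.3(iii)** (kurims p.75) ↦ **Prop 2.1 (ii)**: the full poly-isomorphism (e_ℜ)
`F^{⊢×μ}_{env}(†D_>) ⥲ F^{⊢×μ}_△(†D^⊢_△)` precomposed with the Kummer isomorphism `†F^{⊢×μ}_{env} ⥲ F^{⊢×μ}_{env}(†D_>)` of Prop 2.1 (ii)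
is the full poly-isomorphism `†F^{⊢×μ}_{env} ⥲ F^{⊢×μ}_△(†D^⊢_△)`. [claim: Mochizuki2012, status: disputed] -/
theorem single_kummerEnvAt_comp_envToDelta (X : S.HT) :
    (PolyIso.single (G.kummerEnvAt X)).comp (Radial.envToDelta (E := G.coric) ⟨S.htToD.obj X⟩) =
      PolyIso.full _ (G.coric.fxmOfDv.obj (G.coric.dvDelta.obj (S.htToD.obj X))) :=
  PolyIso.comp_full_of_nonempty ⟨G.kummerEnvAt X, rfl⟩

/-- **IUTchIII:Cor2.3(iii)** (kurims p.75) "The [poly-]isomorphisms of `F^{⊢×μ}`-prime-strips of/induced by (e_ℜ) … are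
compatible, relative to the Kummer isomorphisms of Proposition 2.1, (ii) … and Theorem 1.5, (iii), …": transporting the
full poly-isomorphism (e_ℜ) `F^{⊢×μ}_{env}(†D_>) ⥲ F^{⊢×μ}_△(†D^⊢_△)` to the Frobenius-like strips along the Kummer isomorphism of
Prop 2.1 (ii) on the left and [the inverse of] that of Thm 1.5 (iii) on the right yields the FULL poly-isomorphism
`†F^{⊢×μ}_{env} ⥲ †F^{⊢×μ}_△` (rows Cor-23.iii.r9/r12). [claim: Mochizuki2012, status: disputed] -/
theorem cor23iii_kummer_full (X : S.HT) :
    ((PolyIso.single (G.kummerEnvAt X)).comp (Radial.envToDelta (E := G.coric) ⟨S.htToD.obj X⟩)).comp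
        (PolyIso.single (G.kummerDeltaAt X).symm) = PolyIso.full _ _ := by
  rw [G.single_kummerEnvAt_comp_envToDelta X]
  exact PolyIso.full_comp_of_nonempty ⟨(G.kummerDeltaAt X).symm, rfl⟩

/-- **IUTchIII:Cor2.3(iii)** (kurims p.75) the mechanism of "compatible … with the poly-isomorphisms — arising from the
horizontal arrows … — of Theorem 1.5, (ii)": the Kummer-transported full poly-isomorphism (e_ℜ) followed by ANY nonempty
poly-isomorphism `Q` out of `F^{⊢×μ}_△(†D^⊢_△)` is the full poly-isomorphism. [claim: Mochizuki2012, status: disputed] -/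
theorem cor23iii_comp_full (X : S.HT) {Z : S.Fxm}
    {Q : PolyIso (G.coric.fxmOfDv.obj (G.coric.dvDelta.obj (S.htToD.obj X))) Z}
    (hQ : Q.Nonempty) :
    ((PolyIso.single (G.kummerEnvAt X)).comp (Radial.envToDelta (E := G.coric) ⟨S.htToD.obj X⟩)).comp Q =
      PolyIso.full _ _ := by
  rw [G.single_kummerEnvAt_comp_envToDelta X]
  exact PolyIso.full_comp_of_nonempty hQ

/-- **IUTchIII:Cor2.3(iii)** (kurims p.75) ↦ **Thm 1.5 (ii)** via the hub: (e_ℜ) at `^{n,m}ℜ`, Kummer-transported on the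
left, followed by the `F^{⊢×μ}`-components of the coric identifications `Φ(^{n,m}ℜ) ⥲ Φ(^{n+1,m}ℜ)` of the étale-picture
[`RadialData`'s `horizontalCoricPolyIso`: induced by the full poly-isomorphism of `D^⊢`-prime-strips of Thm 1.5 (ii)]
is the full poly-isomorphism `^{n,m}F^{⊢×μ}_{env} ⥲ F^{⊢×μ}_△(^{n+1,m}D^⊢_△)` = (e_ℜ)-type at `^{n+1,m}ℜ` (row Cor-23.iii.r11).
[claim: Mochizuki2012, status: disputed] -/
theorem cor23iii_hub_full (H : ℤ × ℤ → S.HT) (n m : ℤ) :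
    ((PolyIso.single (G.kummerEnvAt (H (n, m)))).comp
        (Radial.envToDelta (E := G.coric) ⟨S.htToD.obj (H (n, m))⟩)).comp
        ((fun f => f.δ) '' horizontalCoricPolyIso G.coric (fun p => S.htToD.obj (H p)) n m) =
      PolyIso.full _ _ :=
  G.cor23iii_comp_full (H (n, m))
    ((horizontalCoricPolyIso_nonempty G.coric (fun p => S.htToD.obj (H p)) n m).image fun f => f.δ)

/-- **IUTchIII:Cor2.3(iii)** (kurims p.75) ↦ **Thm 1.5 (iii)** (kurims p.50) transport of a Frobenius-like
isomorphism `^{n,m}F^{⊢×μ}_△ ⥲ ^{n',m'}F^{⊢×μ}_△` along the Kummer isomorphisms `kummerDeltaAt` (Thm 1.5 (iii) "compatible with the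
poly-isomorphisms of (ii)"; `BiCoricData.kummerTransport` moved to `RadialData`'s copies along the glue).
[claim: Mochizuki2012, status: disputed] -/
def kummerDeltaTransport {X Y : S.HT} (e : G.biCoric.fxmDeltaHT.obj X ≅ G.biCoric.fxmDeltaHT.obj Y) :
    G.coric.fxmOfDv.obj (G.coric.dvDelta.obj (S.htToD.obj X)) ≅
      G.coric.fxmOfDv.obj (G.coric.dvDelta.obj (S.htToD.obj Y)) :=
  (G.kummerDeltaAt X).symm ≪≫ e ≪≫ G.kummerDeltaAt Y

/-- **IUTchIII:Cor2.3(iii)** (kurims p.75) ↦ **Thm 1.5 (iii)**: `kummerDeltaTransport` is `BiCores`'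
`BiCoricData.kummerTransport` conjugated by the glue identification `fxmDeltaGlueAt`. [claim: Mochizuki2012, status: disputed] -/
theorem kummerDeltaTransport_eq {X Y : S.HT} (e : G.biCoric.fxmDeltaHT.obj X ≅ G.biCoric.fxmDeltaHT.obj Y) :
    G.kummerDeltaTransport e = G.fxmDeltaGlueAt (S.htToD.obj X) ≪≫ G.biCoric.kummerTransport e ≪≫
      (G.fxmDeltaGlueAt (S.htToD.obj Y)).symm := by
  simp only [kummerDeltaTransport, kummerDeltaAt, BiCoricData.kummerTransport, Iso.trans_symm, Iso.symm_symm_eq,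
    Iso.trans_assoc]

/-- **IUTchIII:Cor2.3(iii)** (kurims p.75) ↦ **Thm 1.5 (ii)+(iii)** (kurims pp.48–50): the Kummer transport [Thm 1.5
(iii)] of the FULL poly-isomorphism `^{n,m}F^{⊢×μ}_△ ⥲ ^{n',m}F^{⊢×μ}_△` arising from the horizontal arrows [Thm 1.5 (ii),
`LogThetaLatticeDiagram.horizontal_inducedFxm_full`] is the full poly-isomorphism
`F^{⊢×μ}_△(^{n,m}D^⊢_△) ⥲ F^{⊢×μ}_△(^{n',m}D^⊢_△)` of `RadialData`'s bi-coric strips (`BiCoricData.kummerTransport_image_full`, abc-iut-L6-t3,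
moved along the glue) (sub-DAG rows Cor-23.iii.r11/r12). [claim: Mochizuki2012, status: disputed] -/
theorem image_kummerDeltaTransport_full (X Y : S.HT) :
    G.kummerDeltaTransport '' PolyIso.full (G.biCoric.fxmDeltaHT.obj X) (G.biCoric.fxmDeltaHT.obj Y) =
      PolyIso.full (G.coric.fxmOfDv.obj (G.coric.dvDelta.obj (S.htToD.obj X)))
        (G.coric.fxmOfDv.obj (G.coric.dvDelta.obj (S.htToD.obj Y))) := by
  ext e
  simp only [Set.mem_image, PolyIso.mem_full, true_and, iff_true]
  refine ⟨G.kummerDeltaAt X ≪≫ e ≪≫ (G.kummerDeltaAt Y).symm, ?_⟩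
  simp only [kummerDeltaTransport, Iso.trans_assoc, Iso.symm_self_id, Iso.trans_refl, Iso.symm_self_id_assoc]

/-- **IUTchIII:Cor2.3(iii)** (kurims p.75) ↦ **Thm 1.5 (ii)+(iii)**: (e_ℜ) at `^{n,m}ℜ`, precomposed with the Kummer
isomorphism of Prop 2.1 (ii), followed by the Kummer transport [Thm 1.5 (iii)] of the full poly-isomorphism
`^{n,m}F^{⊢×μ}_△ ⥲ ^{n',m}F^{⊢×μ}_△` arising from the horizontal arrows [Thm 1.5 (ii)], is the full poly-isomorphism
`^{n,m}F^{⊢×μ}_{env} ⥲ F^{⊢×μ}_△(^{n',m}D^⊢_△)` — "(e_ℜ) … compatible, relative to the Kummer isomorphisms of Proposition 2.1, (ii) …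
and Theorem 1.5, (iii), with the poly-isomorphisms — arising from the horizontal arrows of the Gaussian log-theta-lattice
— of Theorem 1.5, (ii)" (sub-DAG rows Cor-23.iii.r9/r11/r12). [claim: Mochizuki2012, status: disputed] -/
theorem cor23iii_horizontal_full (X Y : S.HT) :
    ((PolyIso.single (G.kummerEnvAt X)).comp (Radial.envToDelta (E := G.coric) ⟨S.htToD.obj X⟩)).comp
        (G.kummerDeltaTransport '' PolyIso.full (G.biCoric.fxmDeltaHT.obj X) (G.biCoric.fxmDeltaHT.obj Y)) =
      PolyIso.full _ _ := by
  rw [G.image_kummerDeltaTransport_full]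
  exact G.cor23iii_comp_full X ⟨_, PolyIso.mem_full
    (G.coric.fxmOfDv.mapIso (G.coric.dvDelta.mapIso (S.iso_nonempty_DHT (S.htToD.obj X) (S.htToD.obj Y)).some))⟩

/-- **IUTchIII:Cor2.3(iii)** (kurims p.75) "(b_{Morℜ}), (d_{Morℜ}) [cf. also (e_{Morℜ})] … compatible, relative to the Kummer
isomorphisms of Proposition 2.1, (ii)": for an isomorphism of Hodge theaters `ξ : †HT ⥲ ‡HT` (a constituent of a
vertical arrow), conjugating (e_ℜ) at `†ℜ` on the left by the KUMMER-CONJUGATE of the Frobenius-like induced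
isomorphism `†F^{⊢×μ}_{env} ⥲ ‡F^{⊢×μ}_{env}` [= the (b_{Morℜ})-component of `Radial.Hom.ofDHT D(ξ)`, `kummerEnvAt_conj`] and on
the right by its (d_{Morℜ})-component gives (e_ℜ) at `‡ℜ` (`Radial.Hom.compatible_envToDelta`).
[claim: Mochizuki2012, status: disputed] -/
theorem cor23iii_bMor_compatible {X X' : S.HT} (ξ : X ≅ X') :
    ((PolyIso.single ((G.kummerEnvAt X).symm ≪≫
          (S.FglToFv ⋙ S.FvToFxm).mapIso (G.thetaMonoid.FglEnvHT.mapIso ξ) ≪≫ G.kummerEnvAt X').symm).comp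
        (Radial.envToDelta (E := G.coric) ⟨S.htToD.obj X⟩)).comp
      (PolyIso.single (Radial.Hom.ofDHT (E := G.coric) (R := ⟨S.htToD.obj X⟩) (R' := ⟨S.htToD.obj X'⟩)
        (S.htToD.mapIso ξ)).δ) =
      Radial.envToDelta (E := G.coric) ⟨S.htToD.obj X'⟩ := by
  rw [G.kummerEnvAt_conj ξ]
  exact Radial.Hom.compatible_envToDelta (Radial.Hom.ofDHT (S.htToD.mapIso ξ)) _

end LatticeGlue

end Literature.IUT.LogThetaLattice
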